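import Summits.HodgeConjecture.HodgeConjecture.Theses.DworkReflectionQuotients
import Literature.AlgebraicGeometry.HodgeTheory.DworkSexticFlatEigenclassesHodgeType

/-!
# Crux K2 `FlatClassesSpannedByReflectionInvariants` of route `DworkReflectionQuotients`,
# modulo Griffiths' residue description of the Hodge filtration (Voisin II Thm. 6.5)

Route `route-HodgeConjecture-DworkReflectionQuotients` (cell `hodge-nonav`, rung F-H1 — never summit
credit), item `stmt-HodgeConjecture-20241`; landed `--supports stmt-HodgeConjecture-20241`. A CONDITIONAL
result: its one hypothesis is the tree's named fact `Griffiths1969_residues_span_hodgeFiltration`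
(Griffiths 1969 §8 = Voisin II (6.2)–(6.3), Thm. 6.5, §6.1.3: the residues `Res(PΩ/Fˡ)` span
`F^{n+1-l}Hⁿ` of a smooth hypersurface modulo the ambient classes, naturally for its diagonal
symmetries) — the standard theorem from which Katz 2009 Lemma 3.1 is read off, and the same residual
obligation as the tree's Fermat reductions `Ran1980_fermatEigenspace_hodgeType_pp_of_residues` /
`AokiShioda1983_eigenline_le_neronSeveri_of_residues`. Companion of
`Theorems/DworkReflectionQuotientsK2ModuloKatz` (the same crux modulo `Katz2009_dworkSexticEigenspaces`);
the item stays open until one of the two facts is discharged. Prover seat `hodge-nonav-20241-p1` (g0),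
2026-08-27.

The mathematics is the Literature theorem
`Literature.AlgebraicGeometry.HodgeTheory.DworkSextic.flatClasses_mem_span_reflInvariant_of_griffiths`
(file `DworkSexticFlatEigenclassesHodgeType`, this seat): clauses (ii)–(iii) of Griffiths' fact at pole
order `2` give `V_e ∩ F³H⁴(X_ψ) = 0` for the four flat exponent types `e` (no monomial of degree `6`
carries a flat character of `Γ_W = μ₆⁶ ∩ ker ∏`, so the isotypic projector `π_e` kills
`res₂(S⁶) + ι^*H⁴(ℙ⁵) ⊇ F³`), whence `V_e ⊆ H^{2,2}` by conjugation and the compatibility of the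
character and Hodge decompositions; then the six-reflection averaging identity of
`DworkSexticReflectionAveraging` puts every rational `w = u + v` of a flat piece in the span of rational,
reflection-invariant `(2,2)`-classes. The body of the crux is that statement verbatim, so the proof is
one `exact`.

## References

* P. Griffiths, *On the periods of certain rational integrals I, II*, Ann. of Math. 90 (1969), §8.
  [Griffiths1969]
* C. Voisin, *Hodge Theory and Complex Algebraic Geometry II* (2003), §6.1.2 Thm. 6.5, §6.1.3.
  [VoisinHodgeII2003]
* N. M. Katz, *Another look at the Dwork family*, Progr. Math. 270 (2009), Lemma 3.1. [Katz2009]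
* G. Bini, A. Garbagnati, *Quotients of the Dwork pencil*, J. Geom. Phys. 75 (2014), §3.4.
  [BiniGarbagnati2012]
-/

namespace Summit.HodgeConjecture.HodgeConjecture.Theorems

open Literature.AlgebraicGeometry.HodgeTheory

/-- **Crux K2 modulo Griffiths' residue theorem.** Granted the named fact
`Griffiths1969_residues_span_hodgeFiltration` (Voisin II Thm. 6.5 / §6.1.3 with the naturality of the
residue for diagonal symmetries), the route statement `FlatClassesSpannedByReflectionInvariants` holds:
for `ψ⁶ ≠ 1`, every rational class `w = u + v` of a flat piece `V_{e∘σ} ⊕ V_{(6−e)∘σ}` (`e` one of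
Katz's four flat types, `σ ∈ 𝔖₆`) lies in the `ℂ`-span of the rational `(2,2)`-classes fixed by a
realised reflection `s_(i,i',ζ)`. One `exact` on
`DworkSextic.flatClasses_mem_span_reflInvariant_of_griffiths`. CONDITIONAL on the named fact (trust
base: `Griffiths1969_residues_span_hodgeFiltration`; no use of `Katz2009_dworkSexticEigenspaces`).
[cite: VoisinHodgeII2003, §6.1.2 Thm. 6.5 and §6.1.3] [cite: Katz2009, Lemma 3.1] -/
theorem flatClassesSpannedByReflectionInvariants_of_griffiths
    (hG : Griffiths1969_residues_span_hodgeFiltration) :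
    Summit.HodgeConjecture.HodgeConjecture.Theses.DworkReflectionQuotients.FlatClassesSpannedByReflectionInvariants := by
  intro ψ hψ F X pt IsEig IsRefl j σ w hw huv
  exact DworkSextic.flatClasses_mem_span_reflInvariant_of_griffiths hG hψ j σ w hw huv

end Summit.HodgeConjecture.HodgeConjecture.Theorems
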